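import Mathlib
import Literature.AlgebraicGeometry.Resolution.LocalBlowup
import Literature.AlgebraicGeometry.Resolution.TranscendenceDefect
import Literature.RingTheory.KrullDimension.AffineDimension
import Literature.RingTheory.KrullDimension.LocalizationDimension
import Summits.ResolutionOfSingularities.ResolutionOfSingularities.Theorems.RadicialJungCleanModelsLens5UnimodularRefinement
import Summits.ResolutionOfSingularities.ResolutionOfSingularities.Theorems.RadicialJungCleanModelsLens5UnimodularRefinement2
import Summits.ResolutionOfSingularities.ResolutionOfSingularities.Theorems.RadicialJungCleanModelsLens5UnimodularRefinement3
import Summits.ResolutionOfSingularities.ResolutionOfSingularities.Theorems.RadicialJungCleanModelsLens5UnimodularRefinement4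
import Summits.ResolutionOfSingularities.ResolutionOfSingularities.Theorems.RadicialJungCleanModelsLens5RankOneArchimedean
import Summits.ResolutionOfSingularities.ResolutionOfSingularities.Theorems.RadicialJungCleanModelsLens5PRankTwoPort1
import Summits.ResolutionOfSingularities.ResolutionOfSingularities.Theorems.RadicialJungCleanModelsLens5PRankTwoLattice2
import Summits.ResolutionOfSingularities.ResolutionOfSingularities.Theorems.RadicialJungCleanModelsLens5PRankTwoCurrency
import HarnessLib

/-!
# PORT (T-slice module map §16 (vii), part 3) of res-B-lens-5's `Lens5_PRankTwoAssembly.lean` rev 7: PORT 3 — `port_toricChart_ind` (3-I),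
# `port_toricChart_read` (3-R) and `port_toricChart` (glue over ✓ `port_toricChart_lattice` of `…Lens5PRankTwoLattice2`)

Author res-B-lens-5 (g10); ported verbatim by res-B-lead-1.  OURS; nothing here proves resolution in characteristic `p`.
-/

noncomputable section

set_option linter.dupNamespace false -- mandated namespace of this single-conjunct summit

open IsLocalRing
open Literature.AlgebraicGeometry.Resolution
open Summit.ResolutionOfSingularities.ResolutionOfSingularities.Theorems.RadicialJung.CleanModels
open Summit.ResolutionOfSingularities.ResolutionOfSingularities.Theorems.RadicialJung.CleanModels.Lens5

open Summit.ResolutionOfSingularities.ResolutionOfSingularities.Theorems.RadicialJung.CleanModels.Lens5.PRankTwoCurrency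

namespace Summit.ResolutionOfSingularities.ResolutionOfSingularities.Theorems.RadicialJung.CleanModels.Lens5.PRankTwoAssembly

section PortThree

open AlgebraicGeometry CategoryTheory

set_option linter.unusedVariables false

/-- **PORT 3-I (§3 (IND) of the memo, integer-exponent form).**  Under (P2) for `(x, y)` (`hP`), the relations `x^p = α z^{eA}`,
`y^p = β z^{eB}` (`v α = v β = 1`) and `v(zᵢ) ∈ p·Γ` (`hzV`), the vectors `eA, eB` are independent modulo `p`: an integer relation
`p·C + a·eA + b·eB = 0` forces `p ∣ a` and `p ∣ b`.  PROVED (rev 6). [folklore] -/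
theorem port_toricChart_ind (p : ℕ) [Fact p.Prime] {K : Type} [Field K] (O : ValuationSubring K) {x y : K}
    (hx : x ≠ 0) (hy : y ≠ 0)
    (hP : ∀ a b : ℕ, a < p → b < p → (a ≠ 0 ∨ b ≠ 0) → ∀ z : K, z ≠ 0 →
      O.valuation (x ^ a * y ^ b) ≠ O.valuation (z ^ p))
    (z : Fin 3 → K) (hz0 : ∀ i, z i ≠ 0) (hzV : ∀ i, ∃ w : K, w ≠ 0 ∧ O.valuation (z i) = O.valuation (w ^ p))
    (α β : K) (hα : O.valuation α = 1) (hβ : O.valuation β = 1) (eA eB : Fin 3 → ℤ)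
    (hxA : x ^ p = α * ∏ i, z i ^ eA i) (hyB : y ^ p = β * ∏ i, z i ^ eB i)
    (a b : ℤ) (C : Fin 3 → ℤ) (hrel : ∀ i, (p : ℤ) * C i + a * eA i + b * eB i = 0) :
    (p : ℤ) ∣ a ∧ (p : ℤ) ∣ b := by
  classical
  have hp := (Fact.out : p.Prime)
  have hp0 : (p : ℤ) ≠ 0 := by exact_mod_cast hp.ne_zero
  have hpp : (0 : ℤ) < p := by exact_mod_cast hp.pos
  choose w hw0 hwv using hzV
  -- Euclidean division of `a`, `b` by `p`
  obtain ⟨a₀, ha₀⟩ : ∃ a₀ : ℕ, (a₀ : ℤ) = a % p := ⟨(a % p).toNat, Int.toNat_of_nonneg (Int.emod_nonneg a hp0)⟩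
  obtain ⟨b₀, hb₀⟩ : ∃ b₀ : ℕ, (b₀ : ℤ) = b % p := ⟨(b % p).toNat, Int.toNat_of_nonneg (Int.emod_nonneg b hp0)⟩
  have ha : a = p * (a / p) + a₀ := by rw [ha₀]; exact (Int.mul_ediv_add_emod a p).symm
  have hb : b = p * (b / p) + b₀ := by rw [hb₀]; exact (Int.mul_ediv_add_emod b p).symm
  have ha₀p : a₀ < p := by
    have h := Int.emod_lt_of_pos a hpp
    rw [← ha₀] at h
    exact_mod_cast h
  have hb₀p : b₀ < p := by
    have h := Int.emod_lt_of_pos b hpp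
    rw [← hb₀] at h
    exact_mod_cast h
  by_contra hnot
  have hab : a₀ ≠ 0 ∨ b₀ ≠ 0 := by
    by_contra h
    push Not at h
    obtain ⟨h1, h2⟩ := h
    apply hnot
    refine ⟨Int.dvd_of_emod_eq_zero ?_, Int.dvd_of_emod_eq_zero ?_⟩
    · rw [← ha₀, h1, Nat.cast_zero]
    · rw [← hb₀, h2, Nat.cast_zero]
  -- the witness `Z = (∏ wᵢ^{-Cᵢ}) · x^{-(a/p)} · y^{-(b/p)}`
  set a₁ : ℤ := a / p with ha₁
  set b₁ : ℤ := b / p with hb₁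
  set Z : K := (∏ i, w i ^ (-C i)) * (x ^ (-a₁) * y ^ (-b₁)) with hZ
  have hZ0 : Z ≠ 0 :=
    mul_ne_zero (Finset.prod_ne_zero_iff.mpr fun i _ => zpow_ne_zero _ (hw0 i))
      (mul_ne_zero (zpow_ne_zero _ hx) (zpow_ne_zero _ hy))
  refine hP a₀ b₀ ha₀p hb₀p hab Z hZ0 ?_
  -- the computation in the value group
  set V := O.valuation with hV
  have hVx : V x ≠ 0 := (Valuation.ne_zero_iff V).mpr hx
  have hVy : V y ≠ 0 := (Valuation.ne_zero_iff V).mpr hy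
  have hVz : ∀ i, V (z i) ≠ 0 := fun i => (Valuation.ne_zero_iff V).mpr (hz0 i)
  have hVw : ∀ i, V (w i) ≠ 0 := fun i => (Valuation.ne_zero_iff V).mpr (hw0 i)
  -- `V x ^ p = ∏ V zᵢ ^ eAᵢ`, `V y ^ p = ∏ V zᵢ ^ eBᵢ`, `V zᵢ = V wᵢ ^ p`
  have hXp : V x ^ p = ∏ i, V (z i) ^ eA i := by
    have h := congrArg V hxA
    rw [map_pow, map_mul, hα, one_mul, map_prod] at h
    rw [h]
    exact Finset.prod_congr rfl fun i _ => map_zpow₀ V _ _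
  have hYp : V y ^ p = ∏ i, V (z i) ^ eB i := by
    have h := congrArg V hyB
    rw [map_pow, map_mul, hβ, one_mul, map_prod] at h
    rw [h]
    exact Finset.prod_congr rfl fun i _ => map_zpow₀ V _ _
  have hZW : ∀ i, V (z i) = V (w i) ^ p := fun i => by rw [hwv i, map_pow]
  -- `(V x ^ a · V y ^ b) ^ p = (∏ V zᵢ ^ (-Cᵢ)) ^ p`
  have hN : (V x ^ a * V y ^ b) ^ p = (∏ i, V (z i) ^ (-C i)) ^ p := by
    have e1 : (V x ^ a * V y ^ b) ^ p = (V x ^ p) ^ a * (V y ^ p) ^ b := by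
      rw [mul_pow, ← zpow_natCast (V x ^ a), ← zpow_natCast (V y ^ b), ← zpow_mul, ← zpow_mul,
        mul_comm a, mul_comm b, zpow_mul, zpow_mul, zpow_natCast, zpow_natCast]
    rw [e1, hXp, hYp, ← prod_zpow_smul, ← prod_zpow_smul, ← prod_zpow_add hVz, ← zpow_natCast, ← prod_zpow_smul]
    refine Finset.prod_congr rfl fun i _ => ?_
    congr 1
    have h := hrel i
    linear_combination h
  have hN' : V x ^ a * V y ^ b = ∏ i, V (z i) ^ (-C i) := pow_left_injective_of_ne_zero hp.ne_zero hN
  -- `∏ V zᵢ ^ (-Cᵢ) = (∏ V wᵢ ^ (-Cᵢ)) ^ p`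
  have hNW : ∏ i, V (z i) ^ (-C i) = (∏ i, V (w i) ^ (-C i)) ^ p := by
    rw [← Finset.prod_pow]
    refine Finset.prod_congr rfl fun i _ => ?_
    rw [hZW i, ← zpow_natCast, ← zpow_mul, ← zpow_natCast (V (w i) ^ (-C i)), ← zpow_mul, mul_comm]
  -- atoms `T₁ = V x ^ a₁`, `T₂ = V y ^ b₁`
  have hT₁ : V x ^ a₁ ≠ 0 := zpow_ne_zero _ hVx
  have hT₂ : V y ^ b₁ ≠ 0 := zpow_ne_zero _ hVy
  have hxa : V x ^ a = (V x ^ a₁) ^ p * V x ^ a₀ := by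
    rw [ha, zpow_add₀ hVx, mul_comm (p : ℤ), zpow_mul, zpow_natCast, zpow_natCast]
  have hyb : V y ^ b = (V y ^ b₁) ^ p * V y ^ b₀ := by
    rw [hb, zpow_add₀ hVy, mul_comm (p : ℤ), zpow_mul, zpow_natCast, zpow_natCast]
  have hkey : (V x ^ a₁) ^ p * V x ^ a₀ * ((V y ^ b₁) ^ p * V y ^ b₀) = (∏ i, V (w i) ^ (-C i)) ^ p := by
    rw [← hxa, ← hyb, hN', hNW]
  -- conclude: `V (x^a₀ y^b₀) = V (Z ^ p)`
  have hVZ : V Z = (∏ i, V (w i) ^ (-C i)) * ((V x ^ a₁)⁻¹ * (V y ^ b₁)⁻¹) := by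
    rw [hZ, map_mul, map_mul, map_prod, map_zpow₀, map_zpow₀, zpow_neg, zpow_neg]
    congr 1
    exact Finset.prod_congr rfl fun i _ => map_zpow₀ V _ _
  show V (x ^ a₀ * y ^ b₀) = V (Z ^ p)
  rw [map_pow, map_mul, map_pow, map_pow, hVZ, mul_pow, mul_pow, ← hkey, inv_pow, inv_pow]
  field_simp

/-- **PORT 3-R (the multiplicative reading of a lattice identity).**  If the chart monomials are `u_j = z^{c_j} x^{a_j} y^{b_j}` and the
`p`-scaled exponent of `z^C x^{a₀} y^{b₀}` is the combination `Σ d_j ·` (exponent of `u_j`) — `p·C + a₀ eA + b₀ eB = Σ_j d_j (p c_j + a_j eA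
+ b_j eB)` in `ℤ³` —, then `z^C x^{a₀} y^{b₀} = α^{ia} β^{ib} ∏ u_j^{d_j}`: the defects `Σ d_j a_j − a₀`, `Σ d_j b_j − b₀` are divisible by `p`
by 3-I (`hind`), and `x^p z^{-eA} = α`, `y^p z^{-eB} = β`.  PROVED (rev 6). [folklore] -/
theorem port_toricChart_read (p : ℕ) [Fact p.Prime] {K : Type} [Field K] {x y : K} (hx : x ≠ 0) (hy : y ≠ 0)
    (z : Fin 3 → K) (hz0 : ∀ i, z i ≠ 0) (α β : K) (hα0 : α ≠ 0) (hβ0 : β ≠ 0) (eA eB : Fin 3 → ℤ)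
    (hxA : x ^ p = α * ∏ i, z i ^ eA i) (hyB : y ^ p = β * ∏ i, z i ^ eB i)
    (hind : ∀ (a b : ℤ) (C : Fin 3 → ℤ), (∀ i, (p : ℤ) * C i + a * eA i + b * eB i = 0) → (p : ℤ) ∣ a ∧ (p : ℤ) ∣ b)
    (c : Fin 3 → Fin 3 → ℤ) (a b : Fin 3 → ℕ) (u : Fin 3 → K)
    (hu : ∀ j, u j = (∏ i, z i ^ c j i) * (x ^ a j * y ^ b j))
    (C : Fin 3 → ℤ) (a₀ b₀ : ℕ) (d : Fin 3 → ℤ)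
    (hℓ : ∀ i, (p : ℤ) * C i + (a₀ : ℤ) * eA i + (b₀ : ℤ) * eB i =
      ∑ j, d j * ((p : ℤ) * c j i + (a j : ℤ) * eA i + (b j : ℤ) * eB i)) :
    ∃ ia ib : ℤ, (∏ i, z i ^ C i) * (x ^ a₀ * y ^ b₀) = α ^ ia * β ^ ib * ∏ j, u j ^ d j := by
  classical
  have hp := (Fact.out : p.Prime)
  have hp0 : (p : ℤ) ≠ 0 := by exact_mod_cast hp.ne_zero
  -- expand the right-hand side of `hℓ`
  have key : ∀ i, ∑ j, d j * ((p : ℤ) * c j i + (a j : ℤ) * eA i + (b j : ℤ) * eB i) =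
      (p : ℤ) * (∑ j, d j * c j i) + (∑ j, d j * (a j : ℤ)) * eA i + (∑ j, d j * (b j : ℤ)) * eB i := by
    intro i
    rw [Finset.mul_sum, Finset.sum_mul, Finset.sum_mul, ← Finset.sum_add_distrib, ← Finset.sum_add_distrib]
    exact Finset.sum_congr rfl fun j _ => by ring
  have hrel : ∀ i, (p : ℤ) * (∑ j, d j * c j i - C i) + (∑ j, d j * (a j : ℤ) - a₀) * eA i +
      (∑ j, d j * (b j : ℤ) - b₀) * eB i = 0 := by
    intro i
    have h := hℓ i
    rw [key] at h
    linear_combination -h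
  obtain ⟨⟨a', ha'⟩, ⟨b', hb'⟩⟩ := hind _ _ _ hrel
  -- `Σ d_j c_j = C - a' eA - b' eB`
  have hC : ∀ i, ∑ j, d j * c j i = C i + ((-a') * eA i + (-b') * eB i) := by
    intro i
    have h := hrel i
    rw [ha', hb'] at h
    have h2 : (p : ℤ) * (∑ j, d j * c j i - C i) = (p : ℤ) * ((-a') * eA i + (-b') * eB i) := by linear_combination h
    have h3 := mul_left_cancel₀ hp0 h2
    linear_combination h3
  have hSa : ∑ j, d j * (a j : ℤ) = (a₀ : ℤ) + (p : ℤ) * a' := by linear_combination ha'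
  have hSb : ∑ j, d j * (b j : ℤ) = (b₀ : ℤ) + (p : ℤ) * b' := by linear_combination hb'
  -- nonzero atoms
  have hzA : (∏ i, z i ^ eA i) ≠ 0 := Finset.prod_ne_zero_iff.mpr fun i _ => zpow_ne_zero _ (hz0 i)
  have hzB : (∏ i, z i ^ eB i) ≠ 0 := Finset.prod_ne_zero_iff.mpr fun i _ => zpow_ne_zero _ (hz0 i)
  -- `∏ u_j^{d_j}` expanded
  have hP1 : ∏ j, u j ^ d j =
      (∏ i, z i ^ (∑ j, d j * c j i)) * (x ^ (∑ j, d j * (a j : ℤ)) * y ^ (∑ j, d j * (b j : ℤ))) := by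
    rw [prod_zpow_lincomb hz0, zpow_finsum hx, zpow_finsum hy, ← Finset.prod_mul_distrib, ← Finset.prod_mul_distrib]
    refine Finset.prod_congr rfl fun j _ => ?_
    rw [hu j, mul_zpow, mul_zpow, ← zpow_natCast x, ← zpow_natCast y, ← zpow_mul, ← zpow_mul, mul_comm (d j) (a j : ℤ),
      mul_comm (d j) (b j : ℤ)]
  have hP2 : ∏ j, u j ^ d j = α ^ a' * β ^ b' * ((∏ i, z i ^ C i) * (x ^ a₀ * y ^ b₀)) := by
    rw [hP1]
    rw [show (fun i => z i ^ (∑ j, d j * c j i)) = fun i => z i ^ (C i + ((-a') * eA i + (-b') * eB i)) from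
      funext fun i => by rw [hC i]]
    rw [prod_zpow_add hz0, prod_zpow_add hz0, prod_zpow_smul, prod_zpow_smul, hSa, hSb, zpow_add₀ hx, zpow_add₀ hy,
      zpow_natCast, zpow_natCast, zpow_mul, zpow_mul, zpow_natCast, zpow_natCast, hxA, hyB, mul_zpow, mul_zpow,
      zpow_neg, zpow_neg]
    field_simp
  refine ⟨-a', -b', ?_⟩
  have h1 : α ^ (-a') * α ^ a' = 1 := by rw [zpow_neg]; exact inv_mul_cancel₀ (zpow_ne_zero _ hα0)
  have h2 : β ^ (-b') * β ^ b' = 1 := by rw [zpow_neg]; exact inv_mul_cancel₀ (zpow_ne_zero _ hβ0)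
  rw [hP2]
  calc (∏ i, z i ^ C i) * (x ^ a₀ * y ^ b₀)
      = (α ^ (-a') * α ^ a') * (β ^ (-b') * β ^ b') * ((∏ i, z i ^ C i) * (x ^ a₀ * y ^ b₀)) := by
        rw [h1, h2, one_mul, one_mul]
    _ = α ^ (-a') * β ^ (-b') * (α ^ a' * β ^ b' * ((∏ i, z i ^ C i) * (x ^ a₀ * y ^ b₀))) := by ring


/-- **PORT 3 (§3 of the memo: the toric chart, read in `K`).  Size M (all (S) around the ✓ lattice lemmas).  PROVED (rev 6) from
PORT 3-I + 3-L + 3-R above (kernel-checked glue); the recipe below is the one the proof of 3-L `port_toricChart_lattice` (rev 7, companion file) follows.**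
Recipe (memo §14 CONVENTIONS): `W := Additive (ValuationSubring.ValueGroup O)ˣ`; `hzV` gives `wᵢ ≠ 0` with `v zᵢ = v (wᵢ^p)`; the
`p`-scaled EXPONENT LATTICE `L := pℤ³ + ℤ·eA + ℤ·eB ≤ (Fin 3 → ℤ)` (free of rank 3: `Submodule.basisOfPid` between `pℤ³` and `ℤ³`), the weight
`φ : L →+ W`, `φ ℓ := − Σᵢ ℓᵢ • Additive.ofMul (Units.mk0 (v wᵢ) _)` (so `0 < φ ℓ ⟺ v (μ ℓ) < 1`), and the MONOMIAL MAP `μ (pC + a·eA + b·eB) :=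
z^C x^a y^b` on normalised representatives `0 ≤ a, b < p` — well defined by (IND) (`eA mod p`, `eB mod p` independent in `𝔽_p³`, from `hP` +
`hzV` + `hxA`/`hyB`: `v x = v (∏ wᵢ^{eAᵢ})` by `pow_left_injective` in the value group) and multiplicative UP TO FACTORS `α^i β^j`
(`x^{a+a'} = x^{a+a'-p} · α z^{eA}` when `a + a' ≥ p`).  `hrel`: ✓ `Lens5_RankOneArchimedean.exists_ne_zero_map_eq_zero_of_rank_le_two` with
`Module.rank ℤ W ≤ 2` = ✓ `ratRank_le_two_of_stub O A hAfg (ringKrullDim_eq_three_of_locAtCentre …) htd hk` (`hk` from `hAO`); `hne`: any `zᵢ`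
(`hzv`).  CLASS SPLIT `by_cases hB : ∀ O₁, O ≤ O₁ → O₁ = O ∨ O₁ = ⊤`: class (B) ✓ `archimedean_additive_valueGroup_units O hB` +
✓ `toric_lemma_classB` (rev 9, with kernel clause); class (C): `ψ :=` units map of `ValuationSubring.mapOfLE O O₁` (✓ `monotone_mapOfLE`),
(hW₁)/(hΔ) by ✓ `ker_pair_dependent_of_rank_le_two` / `image_pair_dependent_of_rank_le_two`; ✓ `exists_two_level_reading` → ✓
`toric_lemma_classC` (rev 9).  Its `hne : ∃ ℓ, ψ (φ ℓ) ≠ 0` (some `v(zᵢ) ∉ Δ := ker ψ`) comes from (P2), NOT from «else `v₁` trivial on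
`Frac T`» (memo §14; that only yields a non-monomial witness — the coarse centre on `T` may be `(z₁ − z₂)`-like): if every `v(zᵢ) ∈ Δ` then
`v(x), v(y) ∈ Δ` (`x^p = α z^{eA}`, `W/Δ ↪ W₁` torsion-free), so the `p²` classes of `a·v(x) + b·v(y)` (`0 ≤ a, b < p`) in `Γ/pΓ` — pairwise
distinct by (P2) — would lie in the image `Δ/pΔ` (`Δ` is saturated), which has `≤ p` elements because `Δ` has rational rank `≤ 1` ((hΔ) +
Bezout: `s•x + t•y = 0`, `gcd(s,t) = 1` ⇒ `p ∤ s` or `p ∤ t` ⇒ the classes of `x, y` are dependent) — contradiction (memo rev 12 §15 (a)).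
(Alternative, not needed: if `ψ ∘ φ = 0` then `φ(L) ⊆ Δ` is finitely generated of rational rank `≤ 1`, hence cyclic, `φ = φ₂ • γ₀`, and
✓ `toric_lemma_classB` applies to `φ₂ : L →+ ℤ`.)  `F :=` the `p·δᵢ` (`φ > 0` by `hzv`) and the value-POSITIVE piece exponents `p·e.1 + e.2.1·eA + e.2.2·eB`; value-ZERO
pieces lie in `ker φ`, which the kernel clause of rev 9 places in `ℤ·(chart vectors of value zero)`.  Read the chart: `u j := μ (m_j*)`
(`ρ = 2`: `m₁, m₂, e 2`; `ρ = 1`: `e i₀` first, then the two kernel vectors), `c j`, `a j`, `b j` its normalised exponents; the identities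
`zᵢ = α^· β^· ∏ u_j^{d}` / `μ(ℓ_e) = α^· β^· ∏ u_j^{d}` are `μ` applied to `p δᵢ = Σ d_j m_j*` / `ℓ_e = Σ d_j m_j*`. -/
theorem port_toricChart (p : ℕ) [Fact p.Prime] {k : Type} [Field k] [CharP k p]
    {K : Type} [Field K] [Algebra k K] (O : ValuationSubring K) (A : Subalgebra k K)
    (hAO : A.toSubring ≤ O.toSubring) (hAfg : A.FG) [IsFractionRing A K] (hdimA : ringKrullDim A ≤ 3)
    (hdim3 : ringKrullDim (locAtCentre A.toSubring O) = 3)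
    (htd : ∀ hk : ∀ c : k, algebraMap k K c ∈ O, transcendenceDefect k O hk ≠ 0)
    {x y : K} (hx : x ≠ 0) (hy : y ≠ 0)
    (hP : ∀ a b : ℕ, a < p → b < p → (a ≠ 0 ∨ b ≠ 0) → ∀ z : K, z ≠ 0 →
      O.valuation (x ^ a * y ^ b) ≠ O.valuation (z ^ p))
    (z : Fin 3 → K) (hz0 : ∀ i, z i ≠ 0) (hzv : ∀ i, O.valuation (z i) < 1)
    (hzV : ∀ i, ∃ w : K, w ≠ 0 ∧ O.valuation (z i) = O.valuation (w ^ p))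
    (α β : K) (hα : O.valuation α = 1) (hβ : O.valuation β = 1) (eA eB : Fin 3 → ℤ)
    (hxA : x ^ p = α * ∏ i, z i ^ eA i) (hyB : y ^ p = β * ∏ i, z i ^ eB i)
    (E : Finset ((Fin 3 → ℤ) × (Fin p × Fin p)))
    (hE : ∀ e ∈ E, O.valuation ((∏ i, z i ^ e.1 i) * (x ^ (e.2.1 : ℕ) * y ^ (e.2.2 : ℕ))) ≤ 1) :
    ∃ (ρ : ℕ), (ρ = 1 ∨ ρ = 2) ∧
      ∃ (c : Fin 3 → Fin 3 → ℤ) (a b : Fin 3 → ℕ) (u : Fin 3 → K), (∀ j, a j < p) ∧ (∀ j, b j < p) ∧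
        (∀ j, u j = (∏ i, z i ^ c j i) * (x ^ a j * y ^ b j)) ∧
        (∀ j : Fin 3, (j : ℕ) < ρ → O.valuation (u j) < 1) ∧
        (∀ j : Fin 3, ρ ≤ (j : ℕ) → O.valuation (u j) = 1) ∧
        (∀ i : Fin 3, ∃ (d : Fin 3 → ℤ) (ia ib : ℤ), (∀ j : Fin 3, (j : ℕ) < ρ → 0 ≤ d j) ∧ (∃ j : Fin 3, (j : ℕ) < ρ ∧ 0 < d j) ∧
          z i = α ^ ia * β ^ ib * ∏ j, u j ^ d j) ∧
        (∀ e ∈ E, ∃ (d : Fin 3 → ℤ) (ia ib : ℤ), (∀ j : Fin 3, (j : ℕ) < ρ → 0 ≤ d j) ∧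
          (O.valuation ((∏ i, z i ^ e.1 i) * (x ^ (e.2.1 : ℕ) * y ^ (e.2.2 : ℕ))) = 1 → ∀ j : Fin 3, (j : ℕ) < ρ → d j = 0) ∧
          (∏ i, z i ^ e.1 i) * (x ^ (e.2.1 : ℕ) * y ^ (e.2.2 : ℕ)) = α ^ ia * β ^ ib * ∏ j, u j ^ d j) := by
  classical
  have hα0 : α ≠ 0 := fun h => by rw [h, map_zero] at hα; exact zero_ne_one hα
  have hβ0 : β ≠ 0 := fun h => by rw [h, map_zero] at hβ; exact zero_ne_one hβ
  have hind := port_toricChart_ind p O hx hy hP z hz0 hzV α β hα hβ eA eB hxA hyB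
  obtain ⟨ρ, hρ, c, a, b, ha, hb, hpos, hzero, hzi, hEi⟩ :=
    port_toricChart_lattice p O A hAO hAfg hdimA hdim3 htd hx hy hP z hz0 hzv hzV α β hα hβ eA eB hxA hyB E hE
  refine ⟨ρ, hρ, c, a, b, fun j => (∏ i, z i ^ c j i) * (x ^ a j * y ^ b j), ha, hb, fun j => rfl, hpos, hzero, ?_, ?_⟩
  · intro i
    obtain ⟨d, hd0, hdpos, hℓ⟩ := hzi i
    have hℓ' : ∀ i' : Fin 3, (p : ℤ) * (if i' = i then (1 : ℤ) else 0) + ((0 : ℕ) : ℤ) * eA i' + ((0 : ℕ) : ℤ) * eB i' =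
        ∑ j, d j * ((p : ℤ) * c j i' + (a j : ℤ) * eA i' + (b j : ℤ) * eB i') := by
      intro i'
      rw [← hℓ i', Nat.cast_zero, zero_mul, zero_mul, add_zero, add_zero, mul_ite, mul_one, mul_zero]
    obtain ⟨ia, ib, hread⟩ := port_toricChart_read p hx hy z hz0 α β hα0 hβ0 eA eB hxA hyB hind c a b _ (fun j => rfl)
      (fun i' => if i' = i then (1 : ℤ) else 0) 0 0 d hℓ'
    refine ⟨d, ia, ib, hd0, hdpos, ?_⟩
    rw [← hread, pow_zero, pow_zero, mul_one, mul_one, Finset.prod_eq_single i, if_pos rfl, zpow_one]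
    · intro j _ hj
      rw [if_neg hj, zpow_zero]
    · intro h
      exact absurd (Finset.mem_univ i) h
  · intro e he
    obtain ⟨d, hd0, hd1, hℓ⟩ := hEi e he
    obtain ⟨ia, ib, hread⟩ := port_toricChart_read p hx hy z hz0 α β hα0 hβ0 eA eB hxA hyB hind c a b _ (fun j => rfl)
      e.1 (e.2.1 : ℕ) (e.2.2 : ℕ) d hℓ
    exact ⟨d, ia, ib, hd0, hd1, hread⟩


end PortThree

end Summit.ResolutionOfSingularities.ResolutionOfSingularities.Theorems.RadicialJung.CleanModels.Lens5.PRankTwoAssembly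

end
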